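import Literature.MathematicalPhysics.QuantumLattice.FockRelabel
import HarnessLib

/-!
# Self-duality of the breathing (plaquette) Hubbard family under the diagonal translation

Topic `MathematicalPhysics/QuantumLattice`, family `hubbard` (written for route `CooperPairDMottWalk`,
support `BreathingSelfDual` = stmt-HubbardSuperconductivity-1180, whose typed form quantifies over
every even side `L` and is false at the degenerate side `L = 2`; this file proves the repaired
statement `C′`, the same conclusion for even `L ≥ 4`). The breathing family is
`H_L(a,b,U) = hamiltonian (G \ P) a U + hamiltonian (G ⊓ P) b 0`, `G` the torus graph and `P` the
"different `2 × 2` plaquette" relation. Argument: the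
diagonal translation `x ↦ x + (1,1)` of the torus `(ℤ/Lℤ)²` maps the plaquette tiling
`{2m, 2m+1}²` onto the complementary tiling, hence swaps intra- and inter-plaquette bonds
(`plaquette_flip`), so the translation unitary `W = U_{(1,1)}` of `FockRelabel`
(`fockTranslate`, the second quantisation of the orbital permutation `(x,σ) ↦ (x+(1,1),σ)`, with
its Jordan–Wigner signs) conjugates `H_L(a,b,U)` to `H_L(b,a,U)`; it commutes with `N`, `S^z`
(`relabel_mapEquiv_totalNumber/spinZ`) and fixes the translation-invariant `d`-wave pair field
(`relabel_translate_pairField`). The only new ingredient is the elementary arithmetic of the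
plaquette label `n ↦ n / 2` on `ℤ/Lℤ` for even `L ≥ 4` (`halfLabel_flip`).

Sources: route card cooper-theorem-breathing-self-dual (Yao–Tsai–Kivelson 2007); Bratteli–Robinson II
§5.2.2 (unitary implementation of one-particle permutations). No definition is introduced.
-/

namespace Literature.MathematicalPhysics.QuantumLattice

open Matrix Finset
open Literature.Probability.LatticeModels

/-! ### Arithmetic of the half-label `n ↦ n / 2` on `ℤ/Lℤ`, `L` even, `L ≥ 4` -/

/-- For even `L ≥ 4` and `n < L`, with `m = (n+1) mod L` the successor of `n` on the cycle:
`n` and `m` have the same half-label iff `m` and ITS successor have different half-labels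
(a bond is intra-plaquette iff its translate by one step is inter-plaquette). [folklore] -/
theorem halfLabel_flip {L n : ℕ} (hL : Even L) (h4 : 4 ≤ L) (hn : n < L) :
    (n / 2 = ((n + 1) % L) / 2) ↔ ((n + 1) % L) / 2 ≠ (((n + 1) % L + 1) % L) / 2 := by
  obtain ⟨k, hk⟩ := hL
  rcases Nat.lt_or_ge (n + 1) L with h1 | h1
  · rw [Nat.mod_eq_of_lt h1]
    rcases Nat.lt_or_ge (n + 2) L with h2 | h2
    · rw [Nat.mod_eq_of_lt h2]
      omega
    · have h2' : n + 1 + 1 = L := by omega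
      rw [h2', Nat.mod_self]
      omega
  · have h1' : n + 1 = L := by omega
    rw [h1', Nat.mod_self, zero_add, Nat.mod_eq_of_lt (by omega : 1 < L)]
    omega

/-! ### Coordinates on the fermionic torus -/

section Torus

variable {L : ℕ} [NeZero L]

/-- Coordinates of the diagonal translate: `(x + (1,1))ᵢ = (xᵢ + 1) mod L`. [folklore] -/
theorem ofLex_diag_apply (x : FermionTorus 2 L) (i : Fin 2) :
    (ofLex (FermionTorus.ofTorusEquiv (Equiv.addRight (fun _ : Fin 2 => (1 : ZMod L))) x) i : ℕ) =
      ((ofLex x i : ℕ) + 1) % L := by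
  rw [FermionTorus.ofTorusEquiv_apply, FermionTorus.ofLex_ofTorusSite_apply, Equiv.coe_addRight]
  dsimp only
  rw [Pi.add_apply, FermionTorus.toTorusSite_apply, ZMod.val_add, ZMod.val_natCast,
    ZMod.val_one_eq_one_mod, Nat.mod_eq_of_lt (ofLex x i).isLt, Nat.add_mod_mod]

omit [NeZero L] in
/-- Two natural numbers below `L` with equal casts in `ℤ/Lℤ` are equal. [folklore] -/
theorem nat_eq_of_zmod_cast_eq {a b : ℕ} (ha : a < L) (hb : b < L) (h : (a : ZMod L) = (b : ZMod L)) :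
    a = b := by
  have := (ZMod.natCast_eq_natCast_iff' a b L).1 h
  rwa [Nat.mod_eq_of_lt ha, Nat.mod_eq_of_lt hb] at this

/-- Coordinates of a bond `y = x + eⱼ` of the torus graph: `yᵢ = xᵢ` for `i ≠ j` and
`yⱼ = (xⱼ + 1) mod L`. [folklore] -/
theorem coords_of_eq_add_single {x y : FermionTorus 2 L} {j : Fin 2}
    (h : FermionTorus.toTorusSite y = FermionTorus.toTorusSite x + Pi.single j 1) :
    (∀ i, i ≠ j → (ofLex y i : ℕ) = (ofLex x i : ℕ)) ∧
      (ofLex y j : ℕ) = ((ofLex x j : ℕ) + 1) % L := by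
  constructor
  · intro i hij
    have hi := congr_fun h i
    rw [Pi.add_apply, Pi.single_eq_of_ne hij, add_zero, FermionTorus.toTorusSite_apply,
      FermionTorus.toTorusSite_apply] at hi
    exact nat_eq_of_zmod_cast_eq (ofLex y i).isLt (ofLex x i).isLt hi
  · have hj := congr_arg ZMod.val (congr_fun h j)
    rw [Pi.add_apply, Pi.single_eq_same, FermionTorus.toTorusSite_apply,
      FermionTorus.toTorusSite_apply, ZMod.val_natCast, ZMod.val_add, ZMod.val_natCast,
      ZMod.val_one_eq_one_mod, Nat.mod_eq_of_lt (ofLex y j).isLt,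
      Nat.mod_eq_of_lt (ofLex x j).isLt, Nat.add_mod_mod] at hj
    exact hj

/-- **The diagonal translation swaps intra- and inter-plaquette bonds** (even `L ≥ 4`): for a
bond `y = x + eⱼ`, the translates `x + (1,1)`, `y + (1,1)` lie in different plaquettes iff
`x`, `y` lie in the same plaquette. [folklore] -/
theorem plaquette_flip_of_eq_add_single (hL : Even L) (h4 : 4 ≤ L) {x y : FermionTorus 2 L}
    {j : Fin 2} (h : FermionTorus.toTorusSite y = FermionTorus.toTorusSite x + Pi.single j 1) :
    ((fun i : Fin 2 => (ofLex (FermionTorus.ofTorusEquiv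
          (Equiv.addRight (fun _ : Fin 2 => (1 : ZMod L))) x) i : ℕ) / 2) ≠
        fun i : Fin 2 => (ofLex (FermionTorus.ofTorusEquiv
          (Equiv.addRight (fun _ : Fin 2 => (1 : ZMod L))) y) i : ℕ) / 2) ↔
      ((fun i : Fin 2 => (ofLex x i : ℕ) / 2) = fun i : Fin 2 => (ofLex y i : ℕ) / 2) := by
  obtain ⟨hne, hj⟩ := coords_of_eq_add_single h
  have key := halfLabel_flip hL h4 (ofLex x j).isLt
  simp only [ne_eq, funext_iff, ofLex_diag_apply, not_forall]
  constructor
  · rintro ⟨i, hi⟩ i'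
    by_cases hi' : i' = j
    · subst hi'
      by_cases hij : i = i'
      · subst hij
        rw [hj] at hi ⊢
        exact key.2 hi
      · exact absurd (by rw [hne i hij]) hi
    · rw [hne i' hi']
  · intro hall
    refine ⟨j, ?_⟩
    have hjj := hall j
    rw [hj] at hjj ⊢
    exact key.1 hjj

/-- Symmetric form of `plaquette_flip_of_eq_add_single` over the torus adjacency (either
orientation of the bond). [folklore] -/
theorem plaquette_flip (hL : Even L) (h4 : 4 ≤ L) {x y : FermionTorus 2 L}
    (hxy : (fermionTorusGraph 2 L).Adj x y) :
    ((fun i : Fin 2 => (ofLex (FermionTorus.ofTorusEquiv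
          (Equiv.addRight (fun _ : Fin 2 => (1 : ZMod L))) x) i : ℕ) / 2) ≠
        fun i : Fin 2 => (ofLex (FermionTorus.ofTorusEquiv
          (Equiv.addRight (fun _ : Fin 2 => (1 : ZMod L))) y) i : ℕ) / 2) ↔
      ((fun i : Fin 2 => (ofLex x i : ℕ) / 2) = fun i : Fin 2 => (ofLex y i : ℕ) / 2) := by
  rw [fermionTorusGraph_adj, torusGraph_adj_iff] at hxy
  obtain ⟨-, ⟨j, hj⟩ | ⟨j, hj⟩⟩ := hxy
  · exact plaquette_flip_of_eq_add_single hL h4 hj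
  · rw [ne_comm, eq_comm]
    exact plaquette_flip_of_eq_add_single hL h4 hj

/-- The diagonal translation carries the INTER-plaquette bonds onto the INTRA-plaquette bonds.
[folklore] -/
theorem inf_adj_diag_iff_sdiff_adj (hL : Even L) (h4 : 4 ≤ L) (x y : FermionTorus 2 L) :
    (fermionTorusGraph 2 L ⊓ (⊤ : SimpleGraph (Fin 2 → ℕ)).comap
        (fun (x : FermionTorus 2 L) (i : Fin 2) => (ofLex x i : ℕ) / 2)).Adj
        (FermionTorus.ofTorusEquiv (Equiv.addRight (fun _ : Fin 2 => (1 : ZMod L))) x)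
        (FermionTorus.ofTorusEquiv (Equiv.addRight (fun _ : Fin 2 => (1 : ZMod L))) y) ↔
      (fermionTorusGraph 2 L \ (⊤ : SimpleGraph (Fin 2 → ℕ)).comap
        (fun (x : FermionTorus 2 L) (i : Fin 2) => (ofLex x i : ℕ) / 2)).Adj x y := by
  rw [SimpleGraph.inf_adj, SimpleGraph.sdiff_adj, SimpleGraph.comap_adj, SimpleGraph.comap_adj,
    SimpleGraph.top_adj, SimpleGraph.top_adj, fermionTorusGraph_adj_addRight]
  constructor
  · rintro ⟨hG, hP⟩
    exact ⟨hG, fun h => h ((plaquette_flip hL h4 hG).1 hP)⟩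
  · rintro ⟨hG, hP⟩
    exact ⟨hG, (plaquette_flip hL h4 hG).2 (not_not.1 hP)⟩

/-- The diagonal translation carries the INTRA-plaquette bonds onto the INTER-plaquette bonds.
[folklore] -/
theorem sdiff_adj_diag_iff_inf_adj (hL : Even L) (h4 : 4 ≤ L) (x y : FermionTorus 2 L) :
    (fermionTorusGraph 2 L \ (⊤ : SimpleGraph (Fin 2 → ℕ)).comap
        (fun (x : FermionTorus 2 L) (i : Fin 2) => (ofLex x i : ℕ) / 2)).Adj
        (FermionTorus.ofTorusEquiv (Equiv.addRight (fun _ : Fin 2 => (1 : ZMod L))) x)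
        (FermionTorus.ofTorusEquiv (Equiv.addRight (fun _ : Fin 2 => (1 : ZMod L))) y) ↔
      (fermionTorusGraph 2 L ⊓ (⊤ : SimpleGraph (Fin 2 → ℕ)).comap
        (fun (x : FermionTorus 2 L) (i : Fin 2) => (ofLex x i : ℕ) / 2)).Adj x y := by
  rw [SimpleGraph.inf_adj, SimpleGraph.sdiff_adj, SimpleGraph.comap_adj, SimpleGraph.comap_adj,
    SimpleGraph.top_adj, SimpleGraph.top_adj, fermionTorusGraph_adj_addRight]
  constructor
  · rintro ⟨hG, hP⟩
    exact ⟨hG, fun h => hP ((plaquette_flip hL h4 hG).2 h)⟩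
  · rintro ⟨hG, hP⟩
    exact ⟨hG, fun h => hP ((plaquette_flip hL h4 hG).1 h)⟩

end Torus

/-! ### The Hamiltonian bookkeeping and the repaired self-duality -/

/-- Moving the on-site interaction between the two summands of a breathing Hamiltonian:
`H_X(a,U) + H_Y(b,0) = H_Y(b,U) + H_X(a,0)` (the interaction term does not see the graph). [folklore] -/
theorem hamiltonian_add_hamiltonian_swap_interaction {Λ : Type*} [LinearOrder Λ] [Fintype Λ]
    (X Y : SimpleGraph Λ) {_hX : DecidableRel X.Adj} {_hY : DecidableRel Y.Adj} (a b U : ℝ) :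
    hamiltonian X a U + hamiltonian Y b 0 = hamiltonian Y b U + hamiltonian X a 0 := by
  unfold hamiltonian
  rw [Complex.ofReal_zero, zero_smul, add_zero, add_zero]
  abel

section Breathing

variable {L : ℕ} [NeZero L]

/-- Membership in Mathlib's `Matrix.unitaryGroup` does not depend on the `DecidableEq` instance on
the index type (the instance only enters through `1`; any two are equal). Needed because the route
statement and `FockRelabel.fockRelabel` carry different `DecidableEq` instances on the
configurations `Finset (Orb (FermionTorus 2 L))` (cf. the implementation note of `FockRelabel`).
[folklore] -/
theorem mem_unitaryGroup_of_mem_unitaryGroup {n : Type*} [Fintype n] {d₁ : DecidableEq n}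
    {A : Matrix n n ℂ} (h : A ∈ @Matrix.unitaryGroup n d₁ _ ℂ _ _) (d₂ : DecidableEq n) :
    A ∈ @Matrix.unitaryGroup n d₂ _ ℂ _ _ := by
  have hd : d₁ = d₂ := Subsingleton.elim _ _
  subst hd
  exact h

/-- Conjugation by the translation unitary `U_v` is the relabelling `relabel (Orb.translate v)`
(restated with Mathlib's `star`). [folklore] -/
theorem fockTranslate_conj_eq_relabel (v : TorusSite 2 L)
    (X : Matrix (Finset (Orb (FermionTorus 2 L))) (Finset (Orb (FermionTorus 2 L))) ℂ) :
    (fockTranslate v).val * X * star (fockTranslate v).val = relabel (Orb.translate v) X := by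
  rw [Matrix.star_eq_conjTranspose, ← relabel_eq_fockRelabel_conj]

/-- **The diagonal translation exchanges the two breathing couplings**:
`T_{(1,1)} H_L(a,b,U) T_{(1,1)}⁻¹ = H_L(b,a,U)` for even `L ≥ 4`. [folklore] -/
theorem relabel_translate_breathing (hL : Even L) (h4 : 4 ≤ L) (a b U : ℝ) :
    relabel (Orb.translate (fun _ : Fin 2 => (1 : ZMod L)))
      (hamiltonian (fermionTorusGraph 2 L \ (⊤ : SimpleGraph (Fin 2 → ℕ)).comap
          (fun (x : FermionTorus 2 L) (i : Fin 2) => (ofLex x i : ℕ) / 2)) a U +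
        hamiltonian (fermionTorusGraph 2 L ⊓ (⊤ : SimpleGraph (Fin 2 → ℕ)).comap
          (fun (x : FermionTorus 2 L) (i : Fin 2) => (ofLex x i : ℕ) / 2)) b 0) =
      hamiltonian (fermionTorusGraph 2 L \ (⊤ : SimpleGraph (Fin 2 → ℕ)).comap
          (fun (x : FermionTorus 2 L) (i : Fin 2) => (ofLex x i : ℕ) / 2)) b U +
        hamiltonian (fermionTorusGraph 2 L ⊓ (⊤ : SimpleGraph (Fin 2 → ℕ)).comap
          (fun (x : FermionTorus 2 L) (i : Fin 2) => (ofLex x i : ℕ) / 2)) a 0 := by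
  have h1 : relabel (Orb.translate (fun _ : Fin 2 => (1 : ZMod L)))
      (hamiltonian (fermionTorusGraph 2 L \ (⊤ : SimpleGraph (Fin 2 → ℕ)).comap
          (fun (x : FermionTorus 2 L) (i : Fin 2) => (ofLex x i : ℕ) / 2)) a U) =
      hamiltonian (fermionTorusGraph 2 L ⊓ (⊤ : SimpleGraph (Fin 2 → ℕ)).comap
          (fun (x : FermionTorus 2 L) (i : Fin 2) => (ofLex x i : ℕ) / 2)) a U :=
    relabel_hamiltonian _ _ _ (inf_adj_diag_iff_sdiff_adj hL h4) a U
  have h2 : relabel (Orb.translate (fun _ : Fin 2 => (1 : ZMod L)))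
      (hamiltonian (fermionTorusGraph 2 L ⊓ (⊤ : SimpleGraph (Fin 2 → ℕ)).comap
          (fun (x : FermionTorus 2 L) (i : Fin 2) => (ofLex x i : ℕ) / 2)) b 0) =
      hamiltonian (fermionTorusGraph 2 L \ (⊤ : SimpleGraph (Fin 2 → ℕ)).comap
          (fun (x : FermionTorus 2 L) (i : Fin 2) => (ofLex x i : ℕ) / 2)) b 0 :=
    relabel_hamiltonian _ _ _ (sdiff_adj_diag_iff_inf_adj hL h4) b 0
  rw [relabel_add, h1, h2, hamiltonian_add_hamiltonian_swap_interaction]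

end Breathing

/-- **Repaired `BreathingSelfDual` (`C′`: even `L ≥ 4`)** for route `CooperPairDMottWalk`, item
`stmt-HubbardSuperconductivity-1180`: the translation unitary `W = U_{(1,1)}` conjugates the
breathing Hamiltonian `H_L(a,b,U)` to `H_L(b,a,U)` and commutes with `N`, `S^z` and the `d`-wave
pair field. The item as typed (all even `L`, including `L = 2`) is refuted separately; this is
the statement the route should carry. [folklore] -/
theorem breathingSelfDual_of_four_le :
    let Hb := fun (L : ℕ) (a b U : ℝ) => hamiltonian (fermionTorusGraph 2 L \
      (⊤ : SimpleGraph (Fin 2 → ℕ)).comap (fun (x : FermionTorus 2 L) (i : Fin 2) =>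
        (ofLex x i : ℕ) / 2)) a U + hamiltonian (fermionTorusGraph 2 L ⊓
      (⊤ : SimpleGraph (Fin 2 → ℕ)).comap (fun (x : FermionTorus 2 L) (i : Fin 2) =>
        (ofLex x i : ℕ) / 2)) b 0
    ∀ (L : ℕ) [NeZero L] (a b U : ℝ), Even L → 4 ≤ L →
      ∃ W : Matrix (Finset (Orb (FermionTorus 2 L))) (Finset (Orb (FermionTorus 2 L))) ℂ,
        W ∈ Matrix.unitaryGroup (Finset (Orb (FermionTorus 2 L))) ℂ ∧
        W * Hb L a b U * star W = Hb L b a U ∧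
        W * totalNumber * star W = totalNumber ∧
        W * HubbardWave0.spinZ * star W = HubbardWave0.spinZ ∧
        W * pairField dWaveFormFactor L * star W = pairField dWaveFormFactor L := by
  intro Hb L _ a b U hL h4
  refine ⟨(fockTranslate (fun _ : Fin 2 => (1 : ZMod L))).val, ?_, ?_, ?_, ?_, ?_⟩
  · -- unitarity; the statement's `DecidableEq` instance on configurations differs from the one
    -- `fockRelabel` was built with (see the implementation note of `FockRelabel`), so we transport
    -- the membership across the (subsingleton) instance.
    exact mem_unitaryGroup_of_mem_unitaryGroup
      (fockTranslate (fun _ : Fin 2 => (1 : ZMod L))).property _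
  · rw [fockTranslate_conj_eq_relabel]
    exact relabel_translate_breathing hL h4 a b U
  · rw [fockTranslate_conj_eq_relabel]
    exact relabel_mapEquiv_totalNumber _
  · rw [fockTranslate_conj_eq_relabel]
    exact relabel_mapEquiv_spinZ _
  · rw [fockTranslate_conj_eq_relabel]
    exact relabel_translate_pairField dWaveFormFactor _

end Literature.MathematicalPhysics.QuantumLattice
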